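import Summits.ValiantsHypothesis.ValiantsHypothesis.Theses.BorderApolarity
import Literature.Computability.AlgebraicComplexity.ApolarityAction
import Literature.Computability.AlgebraicComplexity.ApolarityTopPairing
import Summits.ValiantsHypothesis.ValiantsHypothesis.Theorems.ToricFixedPoints.Negative.WithoutOrbitFalse
import Summits.ValiantsHypothesis.ValiantsHypothesis.Theorems.ToricFixedPoints.Negative.WithoutLowerLimitFalse
import Summits.ValiantsHypothesis.ValiantsHypothesis.Theorems.ToricFixedPoints.Negative.WithoutUpperLimitFalse
import Summits.ValiantsHypothesis.ValiantsHypothesis.Theorems.ToricFixedPoints.Negative.InteriorFalse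
import Summits.ValiantsHypothesis.ValiantsHypothesis.Theorems.BorderApolarityToricFixedPointsToricLimitIsInitial
import Summits.ValiantsHypothesis.ValiantsHypothesis.Theorems.BorderApolarityFixedWitnessObstructionQPSocleMax
import Summits.ValiantsHypothesis.ValiantsHypothesis.Theorems.BorderApolarityToricFixedPointsFormToTop

/-!
# Line `form-then-lift` — crux `BorderApolarity.ToricFixedPoints` (stmt-ValiantsHypothesis-5779)

Strategist line (planner-cstrat-stmt-ValiantsHypothesis-5779-s1-0, 2026-08-17): the crux split BY LEVEL,
registered as a skeleton because `route edit --split` is closed to a non-final-cycle seat (gate ruling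
2026-08-15); the identical split (children `ToricTopForm`, `ToricLift`, glue pure logic) is prepared in the
strategist folder (`children.json`, `SplitGlue.lean`) for the tenure planner / final cycle.

* F1 `stub_formDebordering` (FORM level, the GCT content — "toric de-bordering"): a form `F ≠ 0` that is a
  projective limit of translates of `det_m` (`c_t • P_t → F` coefficientwise, `P_t ∈ GL·det_m`) and an
  `H₀(n,m)`-semi-invariant (`M·F = e•F` for every `M` in the route's `H₀`-block; equivalently `F = ℓ^a·G(Y)`
  is a `z`-free `T̃`-weight form) is a TORIC-LIMIT FORM: `F = a • u·(top `w`-component of g·det_m)`.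
  Over End-type top forms (every fibre examined so far: (3,3) cones, (3,4) `ℓ⁴`/`ℓ·det₃Y`, (3,5) `ℓ²det₃Y`,
  (3,7) `ℓ⁴per₃ = det(Grenet)`) it is trivial; its content sits over padded cones with `bdc_pad < dc`
  (Disproof.lean §6b–c; cheapest falsifier `ℓ²·G₃` at `m = 5`).
* F2 `stub_formToTop` (LANDED p142971 + Aux1 p142265, 2026-08-17, lead c2-0 wave 2): F1 at `(n,m)` ⇒ the degree-`m` toric match for every
  `H₀`-fixed Kuratowski-limit point — extract the limit top form `F` with `J_m = Ann_m(F)` (compactness of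
  the projective space of degree-`m` forms + the perfect top pairing, `ApolarityTopPairing`), read
  `H₀`-semi-invariance of `F` off W4 (`Ann(M·F) = {D : MᵀD ∈ Ann F}`, `apolarAction_linSubst_eq_zero_iff`),
  apply F1, and convert "`F ∝ u·top_w(g·det_m)`" into the degree-`m` Kuratowski clauses along the toric
  curve `u·diag((t+2)^w)·g·det_m` with the landed S1 `stub_toricLimitIsInitial` at `k = m`.
* F3 `stub_toricLift` (IDEAL level; = child `ToricLift`): a toric match in degree `m` lifts to a toric match
  in all degrees `k ≤ m` (possibly other `u, g, w`).  Carries the Hilbert-scheme excess; on End-type fibres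
  it IS the crux (the live line's stuck goal lives here, not dodged); conjecturally false off the
  `[pp]`-fibre (saturated tailed two-step (3,5) points, LEAD-REPORT-c1) — but NOT needed by a form-level
  re-glue of `closes` (`stub_socleMax` consumes only the degree-`m` (Ls) clause), which is the point of
  isolating F1.

Composition `ToricFixedPoints_of` is sorry-free and concludes the route decl BY NAME.
Disproof honoured: orbit clause (W1) is kept in F1/F2/F3 (`toricFixedPoints_false_without_orbit`); (Li) and
(Ls) both consumed by F2/F3 (`…_without_lowerLimit/upperLimit`); the interior strengthening is not assumed
anywhere (`InteriorFalse`: F1 allows a translate `g` AND a weight `w`).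
-/

set_option linter.dupNamespace false

namespace Summit.ValiantsHypothesis.ValiantsHypothesis.Cruxes.ToricFixedPoints.FormThenLift

open scoped BigOperators Matrix Topology
open Filter MvPolynomial
open Literature.Computability.AlgebraicComplexity
open Summit.ValiantsHypothesis.ValiantsHypothesis.Theses.BorderApolarity (ToricFixedPoints)

/-! ## §1 Registered stubs -/

/-- F1 — TORIC DE-BORDERING OF FIXED TOP FORMS (FORM level; the bet on the GCT side).  For `3 ≤ n ≤ m`: a
non-zero coefficientwise limit `F` of rescaled translates `c_t • P_t` (`P_t ∈ GL·det_m`) whose line is fixed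
by the route's solvable group `H₀(n,m)` (semi-invariance `M·F = e•F` for every `M` of the `H₀`-block) is, up
to a scalar, a translate of the top weighted-homogeneous component of a translate of `det_m`:
`F = a • u·(weightedHomogeneousComponent w e (g·det_m))` with `e` the maximal `w`-weight.  Equivalently
(Disproof.lean §6b): `bdc_pad(G) ≤ m` for a content-homogeneous `G` forces `G = in_ω(P)`, `dc(P) ≤ m`.
[folklore] -/
theorem stub_formDebordering :
    ∀ (n m : ℕ) [NeZero m], 3 ≤ n → n ≤ m → let rk := fun (p : Fin m × Fin m) => (if (m - n ≤ (p.1 : ℕ) ∧ m - n ≤ (p.2 : ℕ)) ∨ p = (0, 0) then 0 else m * m) + ((p.1 : ℕ) * m + (p.2 : ℕ)); ∀ (P : ℕ → MvPolynomial (Fin m × Fin m) ℂ) (F : MvPolynomial (Fin m × Fin m) ℂ) (c : ℕ → ℂ), (∀ t : ℕ, P t ∈ Literature.Computability.AlgebraicComplexity.glOrbit (Fin m × Fin m) ℂ (Literature.Computability.AlgebraicComplexity.detPoly (Fin m) ℂ)) → F ≠ 0 → Filter.Tendsto (fun t => Literature.Computability.AlgebraicComplexity.coeffVec (c t • P t))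 Filter.atTop (nhds (Literature.Computability.AlgebraicComplexity.coeffVec F)) → (∀ A : Matrix.GeneralLinearGroup (Fin m × Fin m) ℂ, let M : Matrix (Fin m × Fin m) (Fin m × Fin m) ℂ := A; (∀ i j : Fin m × Fin m, M j i ≠ 0 → rk j ≤ rk i) → (∀ i j : Fin m × Fin m, ((m - n ≤ (i.1 : ℕ) ∧ m - n ≤ (i.2 : ℕ)) ∨ i = (0, 0)) → j ≠ i → M j i = 0) → (∀ i k j l : Fin m, m - n ≤ (i : ℕ) → m - n ≤ (k : ℕ) → m - n ≤ (j : ℕ) → m - n ≤ (l : ℕ) → M (i, j) (i, j) * M (k, l) (k, l) = M (i, l) (i, l) * M (k, j) (k, j)) → M (0, 0) (0, 0) ^ (m - n) * ∏ i ∈ Finset.univ.filter (fun i : Fin m => m - n ≤ (i : ℕ)), M (i, i) (i, i) = 1 → ∃ e : ℂ, Literature.Computability.AlgebraicComplexity.linSubst (Fin m × Fin m) ℂ M F = e • F) → ∃ (u g : Matrix.GeneralLinearGroup (Fin m × Fin m) ℂ) (w : Fin m × Fin m → ℕ) (e : ℕ) (a : ℂ), a ≠ 0 ∧ (∀ d ∈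 (Literature.Computability.AlgebraicComplexity.linSubst (Fin m × Fin m) ℂ (g : Matrix (Fin m × Fin m) (Fin m × Fin m) ℂ) (Literature.Computability.AlgebraicComplexity.detPoly (Fin m) ℂ)).support, Finsupp.weight w d ≤ e) ∧ F = a • Literature.Computability.AlgebraicComplexity.linSubst (Fin m × Fin m) ℂ (u : Matrix (Fin m × Fin m) (Fin m × Fin m) ℂ) (MvPolynomial.weightedHomogeneousComponent w e (Literature.Computability.AlgebraicComplexity.linSubst (Fin m × Fin m) ℂ (g : Matrix (Fin m × Fin m) (Fin m × Fin m) ℂ) (Literature.Computability.AlgebraicComplexity.detPoly (Fin m) ℂ))) := by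
  sorry

/-- F2 — FORM LEVEL FEEDS THE DEGREE-`m` TORIC MATCH (true, M–L).  F1 at `(n,m)` implies: for every `(P, J)`
with W1 (orbit), W2 ∧ W3 (Kuratowski limit in degrees `≤ m`), W4 (`H₀`-stability) there are `u, g, w` whose
toric curve `Q_t = u·diag((t+2)^w)·g·det_m` matches `J` in degree `m` ((Li)_m ∧ (Ls)_m).  Proof sketch: pass to
a subsequence with `c_t • P_t → F ≠ 0` (compact projective space of degree-`m` forms); `J_m = Ann_m(F)` by the
perfect top pairing; W4 ⇒ `Ann_m(F) ⊆ Ann_m(M·F)` ⇒ `M·F ∝ F`; F1 gives `F ∝ u·top_w(g·det_m)`; S1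
`stub_toricLimitIsInitial` at `k = m` identifies `Ann_m` of that top form with the degree-`m` Kuratowski
limit along `Q_t` (shift `w : _ → ℕ` into `ℤ`). [folklore] -/
theorem stub_formToTop :
    ∀ (n m : ℕ) [NeZero m], 3 ≤ n → n ≤ m → let act := fun (D f : MvPolynomial (Fin m × Fin m) ℂ) => ∑ e ∈ D.support, ∑ d ∈ f.support, MvPolynomial.monomial (d - e) (MvPolynomial.coeff e D * MvPolynomial.coeff d f * ∏ i ∈ e.support, (Nat.descFactorial (d i) (e i) : ℂ)); let rk := fun (p : Fin m × Fin m) => (if (m - n ≤ (p.1 : ℕ) ∧ m - n ≤ (p.2 : ℕ)) ∨ p = (0, 0) then 0 else m * m) + ((p.1 : ℕ) * m + (p.2 : ℕ)); (∀ (P : ℕ → MvPolynomial (Fin m × Fin m) ℂ) (F : MvPolynomial (Fin m × Fin m) ℂ) (c : ℕ → ℂ), (∀ t : ℕ, P t ∈ Literature.Computability.AlgebraicComplexity.glOrbit (Fin m × Fin m) ℂ (Literature.Computability.AlgebraicComplexity.detPoly (Fin m) ℂ)) → F ≠ 0 → Filter.Tendsto (fun t => Literature.Computability.AlgebraicComplexity.coeffVec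 (c t • P t)) Filter.atTop (nhds (Literature.Computability.AlgebraicComplexity.coeffVec F)) → (∀ A : Matrix.GeneralLinearGroup (Fin m × Fin m) ℂ, let M : Matrix (Fin m × Fin m) (Fin m × Fin m) ℂ := A; (∀ i j : Fin m × Fin m, M j i ≠ 0 → rk j ≤ rk i) → (∀ i j : Fin m × Fin m, ((m - n ≤ (i.1 : ℕ) ∧ m - n ≤ (i.2 : ℕ)) ∨ i = (0, 0)) → j ≠ i → M j i = 0) → (∀ i k j l : Fin m, m - n ≤ (i : ℕ) → m - n ≤ (k : ℕ) → m - n ≤ (j : ℕ) → m - n ≤ (l : ℕ) → M (i, j) (i, j) * M (k, l) (k, l) = M (i, l) (i, l) * M (k, j) (k, j)) → M (0, 0) (0, 0) ^ (m - n) * ∏ i ∈ Finset.univ.filter (fun i : Fin m => m - n ≤ (i : ℕ)), M (i, i) (i, i) = 1 → ∃ e : ℂ, Literature.Computability.AlgebraicComplexity.linSubst (Fin m × Fin m) ℂ M F = e • F) → ∃ (u g : Matrix.GeneralLinearGroup (Fin m × Fin m) ℂ) (w : Fin m × Fin m → ℕ) (e : ℕ) (a : ℂ), a ≠ 0 ∧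 (∀ d ∈ (Literature.Computability.AlgebraicComplexity.linSubst (Fin m × Fin m) ℂ (g : Matrix (Fin m × Fin m) (Fin m × Fin m) ℂ) (Literature.Computability.AlgebraicComplexity.detPoly (Fin m) ℂ)).support, Finsupp.weight w d ≤ e) ∧ F = a • Literature.Computability.AlgebraicComplexity.linSubst (Fin m × Fin m) ℂ (u : Matrix (Fin m × Fin m) (Fin m × Fin m) ℂ) (MvPolynomial.weightedHomogeneousComponent w e (Literature.Computability.AlgebraicComplexity.linSubst (Fin m × Fin m) ℂ (g : Matrix (Fin m × Fin m) (Fin m × Fin m) ℂ) (Literature.Computability.AlgebraicComplexity.detPoly (Fin m) ℂ)))) → ∀ (P : ℕ → MvPolynomial (Fin m × Fin m) ℂ) (J : ℕ → Set (MvPolynomial (Fin m × Fin m) ℂ)), (∀ t : ℕ, P t ∈ Literature.Computability.AlgebraicComplexity.glOrbit (Fin m × Fin m) ℂ (Literature.Computability.AlgebraicComplexity.detPoly (Fin m) ℂ)) → (∀ k ≤ m, ∀ D ∈ J k, ∃ Ds : ℕ → MvPolynomial (Fin m × Fin m) ℂ, (∀ t, (Ds t).IsHomogeneous k ∧ act (Ds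 t) (P t) = 0) ∧ Filter.Tendsto (fun t => Literature.Computability.AlgebraicComplexity.coeffVec (Ds t)) Filter.atTop (nhds (Literature.Computability.AlgebraicComplexity.coeffVec D))) ∧ (∀ k ≤ m, ∀ (D : MvPolynomial (Fin m × Fin m) ℂ) (φ : ℕ → ℕ) (Ds : ℕ → MvPolynomial (Fin m × Fin m) ℂ), StrictMono φ → (∀ t, (Ds t).IsHomogeneous k ∧ act (Ds t) (P (φ t)) = 0) → Filter.Tendsto (fun t => Literature.Computability.AlgebraicComplexity.coeffVec (Ds t)) Filter.atTop (nhds (Literature.Computability.AlgebraicComplexity.coeffVec D)) → D ∈ J k) → (∀ A : Matrix.GeneralLinearGroup (Fin m × Fin m) ℂ, let M : Matrix (Fin m × Fin m) (Fin m × Fin m) ℂ := A; (∀ i j : Fin m × Fin m, M j i ≠ 0 → rk j ≤ rk i) → (∀ i j : Fin m × Fin m, ((m - n ≤ (i.1 : ℕ) ∧ m - n ≤ (i.2 : ℕ)) ∨ i = (0, 0)) → j ≠ i → M j i = 0) → (∀ i k j l : Fin m, m - n ≤ (i : ℕ) → m - n ≤ (k : ℕ) → m - n ≤ (j : ℕ)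 → m - n ≤ (l : ℕ) → M (i, j) (i, j) * M (k, l) (k, l) = M (i, l) (i, l) * M (k, j) (k, j)) → M (0, 0) (0, 0) ^ (m - n) * ∏ i ∈ Finset.univ.filter (fun i : Fin m => m - n ≤ (i : ℕ)), M (i, i) (i, i) = 1 → ∀ k ≤ m, ∀ D ∈ J k, Literature.Computability.AlgebraicComplexity.linSubst (Fin m × Fin m) ℂ Mᵀ D ∈ J k) → ∃ (u g : Matrix.GeneralLinearGroup (Fin m × Fin m) ℂ) (w : Fin m × Fin m → ℤ), let Q : ℕ → MvPolynomial (Fin m × Fin m) ℂ := fun t => Literature.Computability.AlgebraicComplexity.linSubst (Fin m × Fin m) ℂ (u : Matrix (Fin m × Fin m) (Fin m × Fin m) ℂ) (Literature.Computability.AlgebraicComplexity.linSubst (Fin m × Fin m) ℂ (Matrix.diagonal fun i : Fin m × Fin m => ((t : ℂ) + 2) ^ (w i)) (Literature.Computability.AlgebraicComplexity.linSubst (Fin m × Fin m) ℂ (g : Matrix (Fin m × Fin m) (Fin m × Fin m) ℂ) (Literature.Computability.AlgebraicComplexity.detPoly (Fin m) ℂ))); (∀ D ∈ J m, ∃ Ds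 : ℕ → MvPolynomial (Fin m × Fin m) ℂ, (∀ t, (Ds t).IsHomogeneous m ∧ act (Ds t) (Q t) = 0) ∧ Filter.Tendsto (fun t => Literature.Computability.AlgebraicComplexity.coeffVec (Ds t)) Filter.atTop (nhds (Literature.Computability.AlgebraicComplexity.coeffVec D))) ∧ (∀ (D : MvPolynomial (Fin m × Fin m) ℂ) (φ : ℕ → ℕ) (Ds : ℕ → MvPolynomial (Fin m × Fin m) ℂ), StrictMono φ → (∀ t, (Ds t).IsHomogeneous m ∧ act (Ds t) (Q (φ t)) = 0) → Filter.Tendsto (fun t => Literature.Computability.AlgebraicComplexity.coeffVec (Ds t)) Filter.atTop (nhds (Literature.Computability.AlgebraicComplexity.coeffVec D)) → D ∈ J m) :=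
  -- F2 LANDED (p142971, wave 2 of lead c2-0): the Theorems-side theorem has this exact statement.
  Summit.ValiantsHypothesis.ValiantsHypothesis.Theorems.BorderApolarityToricFixedPoints.stub_formToTop

/-- F3 — IDEAL-LEVEL LIFT (= child `ToricLift` of the prepared split; carries the Hilbert-scheme excess).
For `3 ≤ n ≤ m` and `(P, J)` with W1, W2 ∧ W3, W4: a toric curve matching `J` in degree `m` can be replaced
by one matching `J` in every degree `k ≤ m`.  On End-type top forms this is the whole crux; cheapest
falsifier = the saturated tailed two-step `H₀(3,5)`-fixed points (POINT-35-seed7.md). [folklore] -/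
theorem stub_toricLift :
    ∀ (n m : ℕ) [NeZero m], 3 ≤ n → n ≤ m → let act := fun (D f : MvPolynomial (Fin m × Fin m) ℂ) => ∑ e ∈ D.support, ∑ d ∈ f.support, MvPolynomial.monomial (d - e) (MvPolynomial.coeff e D * MvPolynomial.coeff d f * ∏ i ∈ e.support, (Nat.descFactorial (d i) (e i) : ℂ)); let rk := fun (p : Fin m × Fin m) => (if (m - n ≤ (p.1 : ℕ) ∧ m - n ≤ (p.2 : ℕ)) ∨ p = (0, 0) then 0 else m * m) + ((p.1 : ℕ) * m + (p.2 : ℕ)); ∀ (P : ℕ → MvPolynomial (Fin m × Fin m) ℂ) (J : ℕ → Set (MvPolynomial (Fin m × Fin m) ℂ)), (∀ t : ℕ, P t ∈ Literature.Computability.AlgebraicComplexity.glOrbit (Fin m × Fin m) ℂ (Literature.Computability.AlgebraicComplexity.detPoly (Fin m) ℂ)) → (∀ k ≤ m, ∀ D ∈ J k, ∃ Ds : ℕ → MvPolynomial (Fin m × Fin m) ℂ, (∀ t, (Ds t).IsHomogeneous k ∧ act (Ds t) (P t) = 0) ∧ Filter.Tendsto (fun t => Literature.Computability.AlgebraicComplexity.coeffVec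 (Ds t)) Filter.atTop (nhds (Literature.Computability.AlgebraicComplexity.coeffVec D))) ∧ (∀ k ≤ m, ∀ (D : MvPolynomial (Fin m × Fin m) ℂ) (φ : ℕ → ℕ) (Ds : ℕ → MvPolynomial (Fin m × Fin m) ℂ), StrictMono φ → (∀ t, (Ds t).IsHomogeneous k ∧ act (Ds t) (P (φ t)) = 0) → Filter.Tendsto (fun t => Literature.Computability.AlgebraicComplexity.coeffVec (Ds t)) Filter.atTop (nhds (Literature.Computability.AlgebraicComplexity.coeffVec D)) → D ∈ J k) → (∀ A : Matrix.GeneralLinearGroup (Fin m × Fin m) ℂ, let M : Matrix (Fin m × Fin m) (Fin m × Fin m) ℂ := A; (∀ i j : Fin m × Fin m, M j i ≠ 0 → rk j ≤ rk i) → (∀ i j : Fin m × Fin m, ((m - n ≤ (i.1 : ℕ) ∧ m - n ≤ (i.2 : ℕ)) ∨ i = (0, 0)) → j ≠ i → M j i = 0) → (∀ i k j l : Fin m, m - n ≤ (i : ℕ) → m - n ≤ (k : ℕ) → m - n ≤ (j : ℕ) → m - n ≤ (l : ℕ) → M (i, j) (i, j) * M (k, l) (k, l) = M (i, l) (i, l)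 * M (k, j) (k, j)) → M (0, 0) (0, 0) ^ (m - n) * ∏ i ∈ Finset.univ.filter (fun i : Fin m => m - n ≤ (i : ℕ)), M (i, i) (i, i) = 1 → ∀ k ≤ m, ∀ D ∈ J k, Literature.Computability.AlgebraicComplexity.linSubst (Fin m × Fin m) ℂ Mᵀ D ∈ J k) → (∃ (u g : Matrix.GeneralLinearGroup (Fin m × Fin m) ℂ) (w : Fin m × Fin m → ℤ), let Q : ℕ → MvPolynomial (Fin m × Fin m) ℂ := fun t => Literature.Computability.AlgebraicComplexity.linSubst (Fin m × Fin m) ℂ (u : Matrix (Fin m × Fin m) (Fin m × Fin m) ℂ) (Literature.Computability.AlgebraicComplexity.linSubst (Fin m × Fin m) ℂ (Matrix.diagonal fun i : Fin m × Fin m => ((t : ℂ) + 2) ^ (w i)) (Literature.Computability.AlgebraicComplexity.linSubst (Fin m × Fin m) ℂ (g : Matrix (Fin m × Fin m) (Fin m × Fin m) ℂ) (Literature.Computability.AlgebraicComplexity.detPoly (Fin m) ℂ))); (∀ D ∈ J m, ∃ Ds : ℕ → MvPolynomial (Fin m × Fin m) ℂ, (∀ t, (Ds t).IsHomogeneous m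 ∧ act (Ds t) (Q t) = 0) ∧ Filter.Tendsto (fun t => Literature.Computability.AlgebraicComplexity.coeffVec (Ds t)) Filter.atTop (nhds (Literature.Computability.AlgebraicComplexity.coeffVec D))) ∧ (∀ (D : MvPolynomial (Fin m × Fin m) ℂ) (φ : ℕ → ℕ) (Ds : ℕ → MvPolynomial (Fin m × Fin m) ℂ), StrictMono φ → (∀ t, (Ds t).IsHomogeneous m ∧ act (Ds t) (Q (φ t)) = 0) → Filter.Tendsto (fun t => Literature.Computability.AlgebraicComplexity.coeffVec (Ds t)) Filter.atTop (nhds (Literature.Computability.AlgebraicComplexity.coeffVec D)) → D ∈ J m)) → ∃ (u g : Matrix.GeneralLinearGroup (Fin m × Fin m) ℂ) (w : Fin m × Fin m → ℤ), let Q : ℕ → MvPolynomial (Fin m × Fin m) ℂ := fun t => Literature.Computability.AlgebraicComplexity.linSubst (Fin m × Fin m) ℂ (u : Matrix (Fin m × Fin m) (Fin m × Fin m) ℂ) (Literature.Computability.AlgebraicComplexity.linSubst (Fin m × Fin m) ℂ (Matrix.diagonal fun i : Fin m × Fin m => ((t : ℂ) + 2) ^ (w i)) (Literature.Computability.AlgebraicComplexity.linSubst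 (Fin m × Fin m) ℂ (g : Matrix (Fin m × Fin m) (Fin m × Fin m) ℂ) (Literature.Computability.AlgebraicComplexity.detPoly (Fin m) ℂ))); (∀ k ≤ m, ∀ D ∈ J k, ∃ Ds : ℕ → MvPolynomial (Fin m × Fin m) ℂ, (∀ t, (Ds t).IsHomogeneous k ∧ act (Ds t) (Q t) = 0) ∧ Filter.Tendsto (fun t => Literature.Computability.AlgebraicComplexity.coeffVec (Ds t)) Filter.atTop (nhds (Literature.Computability.AlgebraicComplexity.coeffVec D))) ∧ (∀ k ≤ m, ∀ (D : MvPolynomial (Fin m × Fin m) ℂ) (φ : ℕ → ℕ) (Ds : ℕ → MvPolynomial (Fin m × Fin m) ℂ), StrictMono φ → (∀ t, (Ds t).IsHomogeneous k ∧ act (Ds t) (Q (φ t)) = 0) → Filter.Tendsto (fun t => Literature.Computability.AlgebraicComplexity.coeffVec (Ds t)) Filter.atTop (nhds (Literature.Computability.AlgebraicComplexity.coeffVec D)) → D ∈ J k) := by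
  sorry

/-! ## §2 Composition (sorry-free) -/

/-- COMPOSITION (kernel-checked, no `sorry`): F1–F3 imply the crux `BorderApolarity.ToricFixedPoints` BY
NAME — instantiate at `(n, m)`, zeta-reduce the shared `let act / rk` bindings, feed F1 into F2 to get the
degree-`m` toric match, and lift it with F3. [folklore] -/
theorem ToricFixedPoints_of : ToricFixedPoints := by
  intro n m inst h3n hnm
  have hF := @stub_formDebordering n m inst h3n hnm
  have hT := @stub_formToTop n m inst h3n hnm
  have hL := @stub_toricLift n m inst h3n hnm
  dsimp only at hF hT hL ⊢
  intro P J hP hK hS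
  obtain ⟨u, g, w, hm⟩ := hT hF P J hP hK hS
  exact hL P J hP hK hS ⟨u, g, w, hm⟩

end Summit.ValiantsHypothesis.ValiantsHypothesis.Cruxes.ToricFixedPoints.FormThenLift
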